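import Summits.QuantumFields.BalabanUV.Beta.D1BFx.TorusCombKKT
import Summits.QuantumFields.BalabanUV.Beta.D1BFx.StencilKernels

/-!
# `BalabanUV.Beta.D1BFx.TorusAveragingEntries` — road «BF-x», binder row D1, slot (K), X₃(ii) ROUTE T, brick **TB2 3b-Q «𝒬-ENTRY BOOKKEEPING»**
# (owner ruling ρ-g6-3, journal l.22016): the torus matrix `Q̂ := TorusCombKKT.Qhat n p` of Bałaban's straight block averaging `𝒬` in the
# SORTED currency — its `ℤ^{d+1}` ENTRIES as leg indicators, `Q̂ᵀ·Q̂ = (reblock n (qqM n))^` (the `𝒬ᵀ𝒬` stencil of `X1aKer`'s mass term), and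
# `Q̂·(reblock n Ga)^·Q̂ᵀ = (toF (gramM n Ga))^` (the torus coarse Gram of `CoarseGramInverse`) — so that the N-side Woodbury
# (`BorderedInverseMassive.kkt_inv_eq_massiveBlocks`) runs with `Q := Q̂`, `G := (reblock n Ga)^`, `C := (multM …)^` (TB2 3c, owner)

CONTENT (all [folklore] ∕ [our object]; `Q̂`'s rows = coarse bonds `J d p`, columns = fine bonds `I d n p`): §1 `QF n := fBL (sortK n (bhK n))`
(`Qhat_eq`), **`QF_apply_legSum`** (entries = leg indicators `Σ_{j ∈ LegIdx d n} [c = κ ∧ finePt n w z = legPt n κ y j]`), the sorted Kronecker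
evaluation `sum_tsum_sorted_ite`, the contractions `sum_tsum_QF_mul`∕`sum_tsum_mul_QF`, periodicity∕summability∕row bounds of `QF` and `QFᵀ`;
§2 [our object] `qqM n` (`[κ = l]·qqKer n κ x w`), **`compF_trF_QF_QF : compF (trF (QF n)) (QF n) = reblock n (qqM n)`**, **`QhatT_mul_Qhat`**;
§3 (`d = 3`, the coarse Gram `Q̂·Ĝ·Q̂ᵀ = (gramM)^`) is the companion file `TorusAveragingGram`.
NOT HERE: the Woodbury assembly (TB2 3c, owner), `X1aKer`'s other terms, estimates.
HONEST FRAMING (cell contract, verbatim): «discharging `BetaPertH` makes Bałaban's UV stability UNCONDITIONAL — a real constructive-QFT result; it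
is NOT the continuum limit and NOT the Clay problem.»  HONEST DEPENDENCY (verbatim): «continuum YM on T⁴ ⇐ BetaPertH ∧ nine spine estimates (0/9
proved); BetaPertH ⇐ (D1) ∧ (D4) ∧ CAP+tail; G-an2-4 gates asym, D1 and NE2/3/4.»  [folklore] bookkeeping BY NAME over TA1∕TB1, `CoarseGramInverse`,
`StencilKernels`, `FibredPeriodisation`; no `Prop` is minted, nothing is cited, no wall binder is instantiated; 0 sorry.  NOT D1, NOT BetaPertH.
ABSOLUTE RULE (cell, verbatim): «No internally-minted statement may enter as a cited fact. Every hypothesis is either kernel-proved in this package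
or a verbatim quotation of a PUBLISHED theorem with page reference. The manuscript(s) under audit are NOT citable for their own disputed steps — they
are the thing under adjudication; programme-internal (2001/route/tribunal) claims are never citable.»
Provenance: D1 formalisation swarm, unit `b2b-balaban-beta-d1-formalise-leaf-03` (gen 8), brick «K-TB2-Q», 2026-08-20.
-/

noncomputable section

namespace Summit.QuantumFields.BalabanUV.Beta.D1BFx.TorusAveragingEntries

open Matrix Finset
open Literature.Probability.LatticeModels (TorusSite Torus.proj)
open Literature.MathematicalPhysics.QuantumFieldTheory.LatticeForm (repZ quo)
open Literature.MathematicalPhysics.QuantumFieldTheory.Balaban1983to89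
open Literature.MathematicalPhysics.QuantumFieldTheory.Balaban1983to89.Beta
open ExpKernelCalculus (MKer Decays shiftK Zl)
open AffineAveraging (box toSite unitVec contourSum)
open KKTFluctuationKernel (delta1 delta1_apply)
open OneStepResolventKernel (Fib proj_zsmul quo_zsmul)
open OneStepKernelFamily (LegIdx legPt)
open StepDriftWitness (legPt_inl_eq)
open Summit.QuantumFields.BalabanUV.Beta.TameKernelCalculus (Spr decays_of_le)
open Summit.QuantumFields.BalabanUV.Beta.BorderedHessian (bhK bhK_inr_inl)
open Summit.QuantumFields.BalabanUV.Beta.D1BFx.FibredPeriodisation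
open Summit.QuantumFields.BalabanUV.Beta.D1BFx.SortedKernels
open Summit.QuantumFields.BalabanUV.Beta.D1BFx.SortedReblocking
open Summit.QuantumFields.BalabanUV.Beta.D1BFx.SortedPack
open Summit.QuantumFields.BalabanUV.Beta.D1BFx.TorusCombKKT (I J Qhat isPeriodic₂_sortK_bhK)
open Summit.QuantumFields.BalabanUV.Beta.D1BFx.StencilKernels (qqKer qqKer_eq_blockForm)
open scoped BigOperators

variable {d : ℕ} {n : ℕ} [NeZero n]

/-! ## §1 The entries of `Q̂` as leg indicators; the sorted Kronecker evaluation -/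

/-- [our object] `QF n := fBL (sortK n (bhK n))` — the `𝒬` rows of the undressed bordered Hessian in sorted form (`Qhat n p = (QF n)^`). -/
def QF (n : ℕ) [NeZero n] : FKer (d + 1) (Fin (d + 1)) (TorusSite (d + 1) n × Fin (d + 1)) := fBL (sortK n (bhK (d := d) n))

/-- [our object] `Qhat` is the periodisation of `QF`. -/
theorem Qhat_eq (p : ℕ) [NeZero p] : Qhat (d := d) n p = Matrix.of (periodiseF p (QF n)) := rfl

/-- [folklore] The raw entry: `QF n (y,κ) (w,(z,c)) = contourSum n (delta1 c (finePt n w z)) κ y`. -/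
theorem QF_apply (y w : Fin (d + 1) → ℤ) (κ c : Fin (d + 1)) (z : TorusSite (d + 1) n) :
    QF n (y, κ) (w, (z, c)) = contourSum n (delta1 c (finePt n w z)) κ y := by
  rw [QF, show fBL (sortK n (bhK (d := d) n)) (y, κ) (w, (z, c)) = sortK n (bhK n) (y, Sum.inr κ) (w, Sum.inl (z, c)) from rfl,
    sortK_inr_inl, bhK_inr_inl, if_pos (proj_zsmul y), quo_zsmul]

/-- [folklore] **THE ENTRIES OF `Q̂` AS LEG INDICATORS**: `QF n (y,κ) (w,(z,c)) = Σ_{j ∈ LegIdx d n} [c = κ ∧ finePt n w z = legPt n κ y j]`. -/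
theorem QF_apply_legSum (y w : Fin (d + 1) → ℤ) (κ c : Fin (d + 1)) (z : TorusSite (d + 1) n) :
    QF n (y, κ) (w, (z, c))
      = ∑ j ∈ LegIdx d n, if c = κ ∧ finePt n w z = legPt n (Sum.inl κ : Fib d) y j then (1 : ℝ) else 0 := by
  rw [QF_apply, AffineAveraging.contourSum, LegIdx, Finset.sum_product]
  refine Finset.sum_congr rfl fun b _ => Finset.sum_congr rfl fun s _ => ?_
  rw [delta1_apply, legPt_inl_eq]
  by_cases h : c = κ ∧ finePt n w z = (n : ℤ) • y + toSite b + (s : ℤ) • unitVec κ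
  · rw [if_pos h, if_pos ⟨h.1.symm, h.2.symm⟩]
  · rw [if_neg h, if_neg (fun h' => h ⟨h'.1.symm, h'.2.symm⟩)]

/-- [folklore] **THE SORTED KRONECKER EVALUATION**: summing `[c = κ ∧ finePt n w z = X]·g (finePt n w z) c` over the sorted fine index gives `g X κ`. -/
theorem sum_tsum_sorted_ite {G : Type*} [Fintype G] [DecidableEq G] (X : Fin (d + 1) → ℤ) (κ : G) (g : (Fin (d + 1) → ℤ) → G → ℝ) :
    ∑ zc : TorusSite (d + 1) n × G, ∑' w : Fin (d + 1) → ℤ,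
        (if zc.2 = κ ∧ finePt n w zc.1 = X then g (finePt n w zc.1) zc.2 else 0) = g X κ := by
  have key : ∀ zc : TorusSite (d + 1) n × G, (∑' w : Fin (d + 1) → ℤ,
      (if zc.2 = κ ∧ finePt n w zc.1 = X then g (finePt n w zc.1) zc.2 else 0))
        = if zc = (Torus.proj n X, κ) then g X κ else 0 := by
    rintro ⟨z, c⟩
    by_cases hc : c = κ
    · subst hc
      by_cases hz : z = Torus.proj n X
      · subst hz
        rw [if_pos rfl]
        have e : (fun w : Fin (d + 1) → ℤ => if c = c ∧ finePt n w (Torus.proj n X) = X then g (finePt n w (Torus.proj n X)) c else 0)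
            = fun w => if w = quo n X then g X c else 0 := by
          funext w
          by_cases hw : w = quo n X
          · subst hw; rw [finePt_quo_proj, if_pos ⟨rfl, rfl⟩, if_pos rfl]
          · rw [if_neg hw, if_neg]
            rintro ⟨-, h⟩
            exact hw (by rw [← quo_finePt (n := n) w (Torus.proj n X), h])
        rw [e, tsum_ite_eq]
      · rw [if_neg (fun h => hz (Prod.mk.inj h).1)]
        have e : (fun w : Fin (d + 1) → ℤ => if c = c ∧ finePt n w z = X then g (finePt n w z) c else 0) = fun _ => 0 := by
          funext w
          rw [if_neg]
          rintro ⟨-, h⟩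
          exact hz (by rw [← proj_finePt (n := n) w z, h])
        rw [e, tsum_zero]
    · rw [if_neg (fun h => hc (Prod.mk.inj h).2)]
      simp only [hc, false_and, if_false, tsum_zero]
  simp only [key, Finset.sum_ite_eq', Finset.mem_univ, if_true]

/-- [folklore] Contracting `QF` on its fine index against any function: the leg sum of the function (`QF_apply_legSum` + `sum_tsum_sorted_ite`). -/
theorem sum_tsum_QF_mul (y : Fin (d + 1) → ℤ) (κ : Fin (d + 1)) (g : (Fin (d + 1) → ℤ) → Fin (d + 1) → ℝ) :
    ∑ zc : TorusSite (d + 1) n × Fin (d + 1), ∑' w, QF n (y, κ) (w, zc) * g (finePt n w zc.1) zc.2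
      = ∑ j ∈ LegIdx d n, g (legPt n (Sum.inl κ : Fib d) y j) κ := by
  have e : ∀ zc : TorusSite (d + 1) n × Fin (d + 1), ∀ w, QF n (y, κ) (w, zc) * g (finePt n w zc.1) zc.2
      = ∑ j ∈ LegIdx d n, (if zc.2 = κ ∧ finePt n w zc.1 = legPt n (Sum.inl κ : Fib d) y j then g (finePt n w zc.1) zc.2 else 0) := by
    rintro ⟨z, c⟩ w
    rw [QF_apply_legSum, Finset.sum_mul]
    refine Finset.sum_congr rfl fun j _ => ?_
    split_ifs <;> simp
  have hs : ∀ zc : TorusSite (d + 1) n × Fin (d + 1), ∀ j, Summable fun w : Fin (d + 1) → ℤ =>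
      (if zc.2 = κ ∧ finePt n w zc.1 = legPt n (Sum.inl κ : Fib d) y j then g (finePt n w zc.1) zc.2 else 0) := by
    rintro ⟨z, c⟩ j
    refine summable_of_ne_finset_zero (s := {quo n (legPt n (Sum.inl κ : Fib d) y j)}) fun w hw => ?_
    rw [Finset.mem_singleton] at hw
    rw [if_neg]
    rintro ⟨-, h⟩
    exact hw (by rw [← quo_finePt (n := n) w z, h])
  simp only [e]
  rw [show (∑ zc : TorusSite (d + 1) n × Fin (d + 1), ∑' w, ∑ j ∈ LegIdx d n,
      (if zc.2 = κ ∧ finePt n w zc.1 = legPt n (Sum.inl κ : Fib d) y j then g (finePt n w zc.1) zc.2 else 0))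
      = ∑ j ∈ LegIdx d n, ∑ zc : TorusSite (d + 1) n × Fin (d + 1), ∑' w,
      (if zc.2 = κ ∧ finePt n w zc.1 = legPt n (Sum.inl κ : Fib d) y j then g (finePt n w zc.1) zc.2 else 0) from by
    rw [Finset.sum_comm]
    refine Finset.sum_congr rfl fun zc _ => ?_
    exact Summable.tsum_finsetSum fun j _ => hs zc j]
  exact Finset.sum_congr rfl fun j _ => sum_tsum_sorted_ite _ κ g

/-- [folklore] The same contraction with the factors commuted. -/
theorem sum_tsum_mul_QF (y : Fin (d + 1) → ℤ) (κ : Fin (d + 1)) (g : (Fin (d + 1) → ℤ) → Fin (d + 1) → ℝ) :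
    ∑ zc : TorusSite (d + 1) n × Fin (d + 1), ∑' w, g (finePt n w zc.1) zc.2 * QF n (y, κ) (w, zc)
      = ∑ j ∈ LegIdx d n, g (legPt n (Sum.inl κ : Fib d) y j) κ := by
  have h := sum_tsum_QF_mul (n := n) y κ g
  simpa only [mul_comm] using h

/-- [folklore] Each row of `QF` against a bounded-free function is summable (finitely many legs). -/
theorem summable_QF_mul (y : Fin (d + 1) → ℤ) (κ : Fin (d + 1)) (g : (Fin (d + 1) → ℤ) → Fin (d + 1) → ℝ)
    (zc : TorusSite (d + 1) n × Fin (d + 1)) : Summable fun w : Fin (d + 1) → ℤ => QF n (y, κ) (w, zc) * g (finePt n w zc.1) zc.2 := by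
  refine summable_of_ne_finset_zero (s := (LegIdx d n).image fun j => quo n (legPt n (Sum.inl κ : Fib d) y j)) fun w hw => ?_
  rw [QF_apply_legSum, Finset.sum_eq_zero, zero_mul]
  intro j hj
  rw [if_neg]
  rintro ⟨-, h⟩
  exact hw (Finset.mem_image.2 ⟨j, hj, by rw [← h, quo_finePt]⟩)

/-- [folklore] Joint periodicity of the fibres of `QF` (every period). -/
theorem isPeriodic₂_QF (q : ℕ) (κ : Fin (d + 1)) (zc : TorusSite (d + 1) n × Fin (d + 1)) : IsPeriodic₂ q (Kfib (QF n) κ zc) := by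
  unfold QF; exact isPeriodic₂_sortK_bhK n q (Sum.inr κ) (Sum.inl zc)

/-- [folklore] Absolute row summability of the fibres of `QF` and of its transpose (finitely supported rows and columns). -/
theorem summable_abs_QF_row (κ : Fin (d + 1)) (zc : TorusSite (d + 1) n × Fin (d + 1)) (y : Fin (d + 1) → ℤ) :
    Summable fun w => |Kfib (QF n) κ zc y w| := by
  have h := summable_QF_mul (n := n) y κ (fun _ _ => (1 : ℝ)) zc
  simp only [mul_one] at h
  exact h.abs

/-- [folklore] Columns of `QF`: for a fixed fine bond only the coarse bond of its own block contributes. -/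
theorem QF_eq_zero_of_ne {y w : Fin (d + 1) → ℤ} {κ c : Fin (d + 1)} {z : TorusSite (d + 1) n}
    (h : ∀ j ∈ LegIdx d n, finePt n w z ≠ legPt n (Sum.inl κ : Fib d) y j) : QF n (y, κ) (w, (z, c)) = 0 := by
  rw [QF_apply_legSum]
  exact Finset.sum_eq_zero fun j hj => if_neg fun h' => h j hj h'.2

omit [NeZero n] in
/-- [folklore] A leg of the coarse bond `(κ, y)` lies in block `y`: `quo n (legPt n κ y j) = y` for `j ∈ LegIdx d n`. -/
theorem quo_legPt {y : Fin (d + 1) → ℤ} {κ : Fin (d + 1)} {j : (Fin (d + 1) → ℕ) × ℕ} (hj : j ∈ LegIdx d n) :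
    AveragingContours.blk n (legPt n (Sum.inl κ : Fib d) y j - (j.2 : ℤ) • unitVec κ) = y := by
  rw [legPt_inl_eq, add_sub_cancel_right]
  rw [LegIdx, Finset.mem_product] at hj
  exact AveragingContours.blk_block y hj.1

/-- [folklore] Absolute COLUMN summability of `QF`: the coarse rows meeting a fixed fine bond are those of ONE block. -/
theorem summable_abs_QF_col (κ : Fin (d + 1)) (zc : TorusSite (d + 1) n × Fin (d + 1)) (w : Fin (d + 1) → ℤ) :
    Summable fun y => |Kfib (QF n) κ zc y w| := by
  obtain ⟨z, c⟩ := zc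
  refine summable_of_ne_finset_zero (s := (Finset.range n).image fun s : ℕ => AveragingContours.blk n (finePt n w z - (s : ℤ) • unitVec κ))
    fun y hy => ?_
  rw [Kfib_apply, QF_eq_zero_of_ne, abs_zero]
  intro j hj h
  apply hy
  refine Finset.mem_image.2 ⟨j.2, ?_, ?_⟩
  · rw [LegIdx, Finset.mem_product] at hj; exact hj.2
  · rw [h]; exact quo_legPt hj

/-- [folklore] A common row bound for the fibres of `QF` (period-`1` translation invariance is not available; use the explicit finite bound
`n^{d+1}·n` on the number of legs). -/
theorem rowBound_QF (κ : Fin (d + 1)) (zc : TorusSite (d + 1) n × Fin (d + 1)) :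
    RowBound (Kfib (QF n) κ zc) ((LegIdx d n).card : ℝ) := by
  intro y
  refine ⟨summable_abs_QF_row κ zc y, ?_⟩
  have hle : ∀ w, |Kfib (QF n) κ zc y w| ≤ ∑ j ∈ LegIdx d n,
      (if zc.2 = κ ∧ finePt n w zc.1 = legPt n (Sum.inl κ : Fib d) y j then (1 : ℝ) else 0) := by
    intro w
    obtain ⟨z, c⟩ := zc
    rw [Kfib_apply, QF_apply_legSum]
    rw [abs_of_nonneg (Finset.sum_nonneg fun j _ => by split_ifs <;> norm_num)]
  have hs : ∀ j, Summable fun w : Fin (d + 1) → ℤ =>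
      (if zc.2 = κ ∧ finePt n w zc.1 = legPt n (Sum.inl κ : Fib d) y j then (1 : ℝ) else 0) := fun j =>
    summable_of_ne_finset_zero (s := {quo n (legPt n (Sum.inl κ : Fib d) y j)}) fun w hw => by
      rw [Finset.mem_singleton] at hw
      rw [if_neg]
      rintro ⟨-, h⟩
      exact hw (by rw [← quo_finePt (n := n) w zc.1, h])
  calc ∑' w, |Kfib (QF n) κ zc y w|
      ≤ ∑' w, ∑ j ∈ LegIdx d n, (if zc.2 = κ ∧ finePt n w zc.1 = legPt n (Sum.inl κ : Fib d) y j then (1 : ℝ) else 0) :=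
        Summable.tsum_le_tsum hle (summable_abs_QF_row κ zc y) (summable_sum fun j _ => hs j)
    _ = ∑ j ∈ LegIdx d n, ∑' w, (if zc.2 = κ ∧ finePt n w zc.1 = legPt n (Sum.inl κ : Fib d) y j then (1 : ℝ) else 0) :=
        Summable.tsum_finsetSum fun j _ => hs j
    _ ≤ ∑ j ∈ LegIdx d n, (1 : ℝ) := by
        refine Finset.sum_le_sum fun j _ => ?_
        have : ∑' w : Fin (d + 1) → ℤ, (if zc.2 = κ ∧ finePt n w zc.1 = legPt n (Sum.inl κ : Fib d) y j then (1 : ℝ) else 0)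
            ≤ ∑' w : Fin (d + 1) → ℤ, (if w = quo n (legPt n (Sum.inl κ : Fib d) y j) then (1 : ℝ) else 0) := by
          refine Summable.tsum_le_tsum (fun w => ?_) (hs j) (summable_of_ne_finset_zero (s := {quo n (legPt n (Sum.inl κ : Fib d) y j)})
            fun w hw => by rw [Finset.mem_singleton] at hw; rw [if_neg hw])
          by_cases h : zc.2 = κ ∧ finePt n w zc.1 = legPt n (Sum.inl κ : Fib d) y j
          · rw [if_pos h, if_pos (by rw [← quo_finePt (n := n) w zc.1, h.2])]
          · rw [if_neg h]; split_ifs <;> norm_num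
        rw [tsum_ite_eq] at this
        exact this
    _ = ((LegIdx d n).card : ℝ) := by simp

/-! ## §2 `Q̂ᵀ·Q̂ = (𝒬ᵀ𝒬)^` -/

/-- [our object] **THE `𝒬ᵀ𝒬` KERNEL AS A FINE `MKer`**: `qqM n x w κ l := [κ = l]·qqKer n κ x w` (the mass term of `VectorLegKernelForm.X1aKer`). -/
def qqM (n : ℕ) : MKer (d + 1) (Fin (d + 1)) := fun x w κ l => if κ = l then qqKer n κ x w else 0

/-- [folklore] Fibres of the re-blocked `qqM` are summable (a `qqKer` row along an injective re-blocking, or zero off the colour diagonal). -/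
theorem summable_Kfib_reblock_qqM (i j : TorusSite (d + 1) n × Fin (d + 1)) (y : Fin (d + 1) → ℤ) :
    Summable (Kfib (reblock n (qqM (d := d) n)) i j y) := by
  obtain ⟨z, κ⟩ := i
  obtain ⟨z', l⟩ := j
  by_cases h : κ = l
  · have e : Kfib (reblock n (qqM (d := d) n)) (z, κ) (z', l) y = (qqKer n κ (finePt n y z)) ∘ fun y' => finePt n y' z' := by
      funext y'
      simp only [Kfib_reblock, qqM, if_pos h, Function.comp_apply]
    rw [e]
    exact (StencilKernels.summable_qqKer_row n κ _).comp_injective (finePt_left_injective z')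
  · have e : Kfib (reblock n (qqM (d := d) n)) (z, κ) (z', l) y = fun _ => 0 := by
      funext y'
      simp only [Kfib_reblock, qqM, if_neg h]
    rw [e]
    exact summable_zero

omit [NeZero n] in
/-- [folklore] `qqKer` through the legs: `qqKer n κ x w = Σ'_y Σ_{j,i ∈ LegIdx} [x = legPt κ y j]·[w = legPt κ y i]`-type identity in the form used
below: `Σ'_y (Σ_j [x = legPt n κ y j])·(Σ_i [w = legPt n κ y i]) = qqKer n κ x w`. -/
theorem tsum_legInd_mul_legInd (hn : 1 ≤ n) (κ : Fin (d + 1)) (x w : Fin (d + 1) → ℤ) :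
    ∑' y : Fin (d + 1) → ℤ, (∑ j ∈ LegIdx d n, if x = legPt n (Sum.inl κ : Fib d) y j then (1 : ℝ) else 0)
        * (∑ i ∈ LegIdx d n, if w = legPt n (Sum.inl κ : Fib d) y i then (1 : ℝ) else 0) = qqKer n κ x w := by
  -- each leg-indicator sum is `Σ_{s<n} [blk n (x − s•e_κ) = y]`
  have hleg : ∀ v : Fin (d + 1) → ℤ, ∀ y, (∑ j ∈ LegIdx d n, if v = legPt n (Sum.inl κ : Fib d) y j then (1 : ℝ) else 0)
      = ∑ s ∈ Finset.range n, if AveragingContours.blk n (v - (s : ℤ) • unitVec κ) = y then (1 : ℝ) else 0 := by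
    intro v y
    rw [LegIdx, Finset.sum_product, Finset.sum_comm]
    refine Finset.sum_congr rfl fun s _ => ?_
    rw [← StencilKernels.sum_box_ite_eq n hn]
    refine Finset.sum_congr rfl fun b _ => ?_
    rw [legPt_inl_eq]
    have e : (v = (n : ℤ) • y + toSite b + (s : ℤ) • unitVec κ) ↔ (v - (s : ℤ) • unitVec κ = (n : ℤ) • y + toSite b) := by
      constructor
      · intro h; rw [h, add_sub_cancel_right]
      · intro h; rw [← h, sub_add_cancel]
    simp only [e]
  simp only [hleg]
  rw [qqKer_eq_blockForm n hn]
  -- `Σ'_y (Σ_s [B_s = y])(Σ_{s'} [B'_{s'} = y]) = Σ_s Σ_{s'} [B'_{s'} = B_s]`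
  have hfin : ∀ s s' : ℕ, Summable fun y : Fin (d + 1) → ℤ =>
      (if AveragingContours.blk n (x - (s : ℤ) • unitVec κ) = y then (1 : ℝ) else 0)
        * (if AveragingContours.blk n (w - (s' : ℤ) • unitVec κ) = y then (1 : ℝ) else 0) := fun s s' =>
    summable_of_ne_finset_zero (s := {AveragingContours.blk n (x - (s : ℤ) • unitVec κ)}) fun y hy => by
      rw [Finset.mem_singleton] at hy
      rw [if_neg (fun h => hy h.symm), zero_mul]
  simp only [Finset.sum_mul_sum]
  rw [Summable.tsum_finsetSum fun s _ => summable_sum fun s' _ => hfin s s']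
  refine Finset.sum_congr rfl fun s _ => ?_
  rw [Summable.tsum_finsetSum fun s' _ => hfin s s']
  refine Finset.sum_congr rfl fun s' _ => ?_
  rw [tsum_eq_single (AveragingContours.blk n (x - (s : ℤ) • unitVec κ))]
  · rw [if_pos rfl, one_mul]
  · intro y hy
    rw [if_neg (fun h => hy h.symm), zero_mul]

set_option maxHeartbeats 800000 in
/-- [folklore] **`𝒬ᵀ𝒬` IN SORTED FORM**: `compF (trF (QF n)) (QF n) = reblock n (qqM n)`. -/
theorem compF_trF_QF_QF (hn : 1 ≤ n) : compF (trF (QF (d := d) n)) (QF n) = reblock n (qqM n) := by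
  funext ⟨w, z, c⟩ ⟨w', z', c'⟩
  rw [reblock_apply]
  simp only [compF, trF_apply, qqM]
  -- both `QF` factors as leg-indicator sums
  simp only [QF_apply_legSum]
  rw [Fintype.sum_eq_single c ?_]
  · by_cases hcc : c = c'
    · subst hcc
      rw [if_pos rfl, ← tsum_legInd_mul_legInd hn c (finePt n w z) (finePt n w' z')]
      refine tsum_congr fun y => ?_
      congr 1
      · refine Finset.sum_congr rfl fun j _ => ?_
        simp only [true_and]
      · refine Finset.sum_congr rfl fun i _ => ?_
        simp only [true_and]
    · rw [if_neg hcc]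
      have e : (fun y : Fin (d + 1) → ℤ =>
          (∑ j ∈ LegIdx d n, if c = c ∧ finePt n w z = legPt n (Sum.inl c : Fib d) y j then (1 : ℝ) else 0) *
            ∑ j ∈ LegIdx d n, if c' = c ∧ finePt n w' z' = legPt n (Sum.inl c : Fib d) y j then (1 : ℝ) else 0) = fun _ => 0 := by
        funext y
        rw [Finset.sum_eq_zero (s := LegIdx d n) (f := fun j =>
          if c' = c ∧ finePt n w' z' = legPt n (Sum.inl c : Fib d) y j then (1 : ℝ) else 0) fun j _ => if_neg fun h => hcc h.1.symm,
          mul_zero]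
      rw [e, tsum_zero]
  · intro κ hκ
    have e : (fun y : Fin (d + 1) → ℤ =>
        (∑ j ∈ LegIdx d n, if c = κ ∧ finePt n w z = legPt n (Sum.inl κ : Fib d) y j then (1 : ℝ) else 0) *
          ∑ j ∈ LegIdx d n, if c' = κ ∧ finePt n w' z' = legPt n (Sum.inl κ : Fib d) y j then (1 : ℝ) else 0) = fun _ => 0 := by
      funext y
      rw [Finset.sum_eq_zero (s := LegIdx d n) (f := fun j =>
        if c = κ ∧ finePt n w z = legPt n (Sum.inl κ : Fib d) y j then (1 : ℝ) else 0) fun j _ => if_neg fun h => hκ h.1.symm, zero_mul]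
    rw [e, tsum_zero]

/-- [folklore] Rows of the transposed `QF` (= columns of `QF`) are absolutely summable, in the exact `Kfib (trF ·)` form. -/
theorem summable_abs_trF_QF_row (zc : TorusSite (d + 1) n × Fin (d + 1)) (κ : Fin (d + 1)) (w : Fin (d + 1) → ℤ) :
    Summable fun y => |Kfib (trF (QF (d := d) n)) zc κ w y| :=
  summable_abs_QF_col κ zc w

/-- [folklore] **`Q̂ᵀ·Q̂ = (reblock n (qqM n))^`** on every coarse torus `Site (d+1) p`. -/
theorem QhatT_mul_Qhat (p : ℕ) [NeZero p] :
    (Qhat (d := d) n p)ᵀ * Qhat (d := d) n p = Matrix.of (periodiseF p (reblock n (qqM (d := d) n))) := by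
  have hn : 1 ≤ n := NeZero.one_le
  have h1 : (Qhat (d := d) n p)ᵀ = Matrix.of (periodiseF p (trF (QF n))) := by
    rw [Qhat_eq, periodiseF_trF (fun κ zc => isPeriodic₂_QF p κ zc)]
  have h2 := periodiseF_compF_matrix (s := p) (summable_abs_trF_QF_row (d := d) (n := n))
    (fun κ zc => isPeriodic₂_QF (d := d) (n := n) p κ zc) (fun κ zc => rowBound_QF (d := d) (n := n) κ zc)
  rw [compF_trF_QF_QF hn] at h2
  rw [h1, Qhat_eq, ← h2]

end Summit.QuantumFields.BalabanUV.Beta.D1BFx.TorusAveragingEntries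

end
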